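import Summits.BirchSwinnertonDyer.BirchSwinnertonDyer.Theorems.ByReductionTypeAtTwoMultTransportArchLocal
import HarnessLib

/-!
# T-42-mult in the kernel, Stage B III-c: the half-point lemma — complex conjugation acts by `−1` on the
# halves of `T₃` (`Δ_E > 0`)

Cell `bsd-2adic` (run/shared/lean/pub/bsd-2adic/), seat `bsd-2adic-t42` (BRIEF-T42, DESIGN-T42 §5 item
K-arch1). HONEST FRAMING: research route; theorems only (no `def`, no named fact, nothing booked).

Setting as in file III-b (`E/ℚ`, the infinite place `w`, `ℚ_w ≅ ℝ`, `E(ℚ̄_w)`, three roots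
`e₁, e₂, e₃ ∈ ℚ_w` of the `2`-division cubic with `(e₃ − e₁)(e₃ − e₂) = s²`, `s ∈ ℚ_w`, and
`T₃ = (e₃, ·) ∉ 2E(ℚ_w)` — file III-a). **`resGal_smul_eq_neg_of_add_self_eq_T₃`** — THE HALF-POINT
LEMMA: if `a ∈ E(ℚ̄)` satisfies `2a = T₃` then every complex conjugation `c` (`σ ≠ 1` in `Γ_{ℚ_w}`) acts
by `c • a = −a`. The duplication formula measured at `e₃` (tree `four_mul_addX_self_sub_mul_sq`,
Silverman III.2.3(d)) gives `(x(a) − e₃)² = (e₃ − e₁)(e₃ − e₂) = s²` (`dup_const_eq`,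
`exists_fst_eq_algebraMap_of_add_self_eq_T₃`), so `x(a) = e₃ ± s ∈ ℚ_w` and `c • a = ±a`; `c • a = a`
would make `a` real (Galois descent) and `T₃ ∈ 2E(ℚ_w)`, impossible. This is Greenberg's "`C_∞[2]` is
generated by the point of `E(ℝ)[2]` with minimal `x`" (LNM 1716 Remark p. 174) at the level of points:
`c • a − a = T₃` for every half `a` of `T₃`, whence `C_∞[2] = ((c − 1)E[2^∞])[2] = ⟨T₃⟩` (file III-d).

References: [GreenbergLNM1716] §5 p. 168 and Remark p. 174; [Matsuno2008] Prop. 4.4 (`v ∈ Σ_+`);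
[SilvermanAEC2009] III.2.3(d), VIII.1.
-/

set_option autoImplicit false

set_option linter.dupNamespace false

noncomputable section

open scoped Classical

universe u

namespace Summit.BirchSwinnertonDyer.BirchSwinnertonDyer.Theorems.MultTransportAtTwo

open NumberField Field WeierstrassCurve WeierstrassCurve.Affine
  Literature.NumberTheory.EllipticCurves Literature.NumberTheory.GaloisRepresentations

variable (W : WeierstrassCurve ℚ) [W.IsElliptic] (w : InfinitePlace ℚ)

/-! ## §3. The half-point lemma: `2a = T₃ ⟹ c • a = −a` -/

section HalfPoint

variable {e₁ e₂ e₃ s : w.Completion}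

/-- **`g′(e₃)/2 = 2(e₃ − e₁)(e₃ − e₂)`** for the split cubic (the constant of the duplication formula
measured at `e₃`, cf. tree `four_mul_addX_self_sub_mul_sq`). [cite: SilvermanAEC2009, III.2.3(d)] -/
theorem dup_const_eq {F : Type*} [Field F] {V : Affine F} {f₁ f₂ f₃ : F} (h : V.SplitTwoTorsion f₁ f₂ f₃) :
    V.a₁ ^ 2 * f₃ + V.a₁ * V.a₃ + 4 * V.a₂ * f₃ + 2 * V.a₄ + 6 * f₃ ^ 2 =
      2 * ((f₃ - f₁) * (f₃ - f₂)) := by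
  linear_combination f₃ * h.a₂_eq + h.a₄_eq

omit [W.IsElliptic] in
/-- The ordinate of `T₃` read in `ℚ̄_w` is `twoTorsionY` there. [folklore] -/
theorem algebraMap_twoTorsionY (e : w.Completion) :
    algebraMap w.Completion (AlgebraicClosure w.Completion) ((W.baseChange w.Completion).toAffine.twoTorsionY e) =
      (W.baseChange (AlgebraicClosure w.Completion)).toAffine.twoTorsionY (algebraMap w.Completion _ e) := by
  have hW : W.baseChange (AlgebraicClosure w.Completion) =
      (W.baseChange w.Completion).map (algebraMap w.Completion (AlgebraicClosure w.Completion)) := by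
    change W.map _ = (W.map _).map _
    rw [WeierstrassCurve.map_map, ← IsScalarTower.algebraMap_eq]
  simp only [WeierstrassCurve.Affine.twoTorsionY, hW, WeierstrassCurve.map_a₁, WeierstrassCurve.map_a₃,
    map_div₀, map_neg, map_add, map_mul, map_ofNat]

omit [W.IsElliptic] in
/-- **The abscissa of a half of `T₃` is real**: in `E(ℚ̄_w)`, if `Q = (X, Y)` satisfies
`2Q = T₃ = (e₃, ·)` and `(e₃ − e₁)(e₃ − e₂) = s²` with `s ∈ ℚ_w`, then `X = e₃ ± s ∈ ℚ_w`: the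
duplication formula gives `(X − e₃)² = (e₃ − e₁)(e₃ − e₂)`. [cite: SilvermanAEC2009, III.2.3(d)]
[cite: GreenbergLNM1716, §5 Remark p. 174] -/
theorem exists_fst_eq_algebraMap_of_add_self_eq_T₃
    (h : (W.baseChange w.Completion).toAffine.SplitTwoTorsion e₁ e₂ e₃)
    (hs : (e₃ - e₁) * (e₃ - e₂) = s ^ 2)
    {X Y : AlgebraicClosure w.Completion}
    (hXY : (W.baseChange (AlgebraicClosure w.Completion)).toAffine.Nonsingular X Y)
    (h₃ : (W.baseChange (AlgebraicClosure w.Completion)).toAffine.Nonsingular (algebraMap w.Completion _ e₃)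
      (algebraMap w.Completion _ ((W.baseChange w.Completion).toAffine.twoTorsionY e₃)))
    (h2 : (WeierstrassCurve.Affine.Point.some X Y hXY :
        (W.baseChange (AlgebraicClosure w.Completion)).toAffine.Point) + .some X Y hXY = .some _ _ h₃) :
    X = algebraMap w.Completion _ (e₃ + s) ∨ X = algebraMap w.Completion _ (e₃ - s) := by
  have hsplit := splitTwoTorsion_algebraicClosure W w h
  have h2ne : (2 : AlgebraicClosure w.Completion) ≠ 0 := by
    haveI : CharZero (AlgebraicClosure w.Completion) :=
      charZero_of_injective_algebraMap (algebraMap ℚ (AlgebraicClosure w.Completion)).injective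
    exact two_ne_zero
  -- `Y ≠ -Y - a₁X - a₃` (else `2Q = O ≠ T₃`)
  have hYne : Y ≠ (W.baseChange (AlgebraicClosure w.Completion)).toAffine.negY X Y := by
    intro hY
    rw [WeierstrassCurve.Affine.Point.add_self_of_Y_eq hY] at h2
    exact WeierstrassCurve.Affine.Point.some_ne_zero _ h2.symm
  rw [WeierstrassCurve.Affine.Point.add_self_of_Y_ne hYne] at h2
  have hX2 := (WeierstrassCurve.Affine.Point.some.inj h2).1
  -- the duplication formula measured at `e₃`
  have hT : algebraMap w.Completion (AlgebraicClosure w.Completion)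
      ((W.baseChange w.Completion).toAffine.twoTorsionY e₃) =
      -algebraMap w.Completion (AlgebraicClosure w.Completion)
        ((W.baseChange w.Completion).toAffine.twoTorsionY e₃) -
        (W.baseChange (AlgebraicClosure w.Completion)).toAffine.a₁ * algebraMap w.Completion _ e₃ -
        (W.baseChange (AlgebraicClosure w.Completion)).toAffine.a₃ := by
    have e := (@negY_twoTorsionY (AlgebraicClosure w.Completion) _
      (W.baseChange (AlgebraicClosure w.Completion)).toAffine
      (charZero_of_injective_algebraMap (algebraMap ℚ (AlgebraicClosure w.Completion)).injective)
      (algebraMap w.Completion (AlgebraicClosure w.Completion) e₃)).symm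
    rw [← algebraMap_twoTorsionY W w e₃, WeierstrassCurve.Affine.negY] at e
    exact e
  have hℓ : (W.baseChange (AlgebraicClosure w.Completion)).toAffine.slope X X Y Y *
      (Y - (-Y - (W.baseChange (AlgebraicClosure w.Completion)).toAffine.a₁ * X -
        (W.baseChange (AlgebraicClosure w.Completion)).toAffine.a₃)) =
      3 * X ^ 2 + 2 * (W.baseChange (AlgebraicClosure w.Completion)).toAffine.a₂ * X +
        (W.baseChange (AlgebraicClosure w.Completion)).toAffine.a₄ -
        (W.baseChange (AlgebraicClosure w.Completion)).toAffine.a₁ * Y := by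
    rw [WeierstrassCurve.Affine.slope_of_Y_ne rfl hYne]
    exact div_mul_cancel₀ _ (sub_ne_zero.mpr hYne)
  have key := (W.baseChange (AlgebraicClosure w.Completion)).toAffine.four_mul_addX_self_sub_mul_sq
    ((WeierstrassCurve.Affine.equation_iff ..).mp hXY.1) ((WeierstrassCurve.Affine.equation_iff ..).mp h₃.1)
    hT hℓ
  rw [hX2, sub_self, mul_zero, zero_mul, dup_const_eq hsplit] at key
  -- `(X - e₃)² = (e₃ - e₁)(e₃ - e₂) = s²` in `ℚ̄_w`
  have hs' : (algebraMap w.Completion (AlgebraicClosure w.Completion) e₃ - algebraMap w.Completion _ e₁) *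
      (algebraMap w.Completion _ e₃ - algebraMap w.Completion _ e₂) =
      (algebraMap w.Completion (AlgebraicClosure w.Completion) s) ^ 2 := by
    rw [← map_sub, ← map_sub, ← map_mul, hs, map_pow]
  have h0 := pow_eq_zero_iff (by norm_num : (2 : ℕ) ≠ 0) |>.mp key.symm
  rw [hs'] at h0
  have hsq : (X - algebraMap w.Completion (AlgebraicClosure w.Completion) e₃) ^ 2 =
      (algebraMap w.Completion (AlgebraicClosure w.Completion) s) ^ 2 := by
    have : (2 : AlgebraicClosure w.Completion) * ((X - algebraMap w.Completion _ e₃) ^ 2 -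
        (algebraMap w.Completion (AlgebraicClosure w.Completion) s) ^ 2) = 0 := by
      linear_combination h0
    exact sub_eq_zero.mp ((mul_eq_zero.mp this).resolve_left h2ne)
  rcases sq_eq_sq_iff_eq_or_eq_neg.mp hsq with hx | hx
  · left; rw [map_add]; linear_combination hx
  · right; rw [map_sub]; linear_combination hx

omit [W.IsElliptic] in
/-- **THE HALF-POINT LEMMA.** Let `e₁, e₂, e₃ ∈ ℚ_w` split the `2`-division cubic with
`(e₃ − e₁)(e₃ − e₂) = s²` (`s ∈ ℚ_w`) and `T₃ = (e₃, ·) ∉ 2E(ℚ_w)` (file III-a), and let `T ∈ E(ℚ̄)`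
map to `T₃`. If `a ∈ E(ℚ̄)` satisfies `2a = T`, then every `σ ≠ 1` in `Γ_{ℚ_w}` (complex
conjugation) acts by **`resGal σ • a = −a`**: the abscissa of `a` is real, so `σ` fixes it and
`resGal σ • a = ±a`; `+` would make `a` real (fixed by all of `Γ_{ℚ_w} = {1, σ}`), hence `ℚ_w`-rational
by descent, and then `T₃ = 2a ∈ 2E(ℚ_w)`. Greenberg, LNM 1716 p. 174: `C_∞[2]` is generated by the
point of minimal abscissa. [cite: GreenbergLNM1716, §5 Remark p. 174] [cite: SilvermanAEC2009, III.2.3(d)] -/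
theorem resGal_smul_eq_neg_of_add_self_eq_T₃
    (h : (W.baseChange w.Completion).toAffine.SplitTwoTorsion e₁ e₂ e₃)
    (hs : (e₃ - e₁) * (e₃ - e₂) = s ^ 2)
    (h₃w : (W.baseChange w.Completion).toAffine.Nonsingular e₃ ((W.baseChange w.Completion).toAffine.twoTorsionY e₃))
    (hT₃ : ∀ Q : (W.baseChange w.Completion).toAffine.Point, Q + Q ≠ .some _ _ h₃w)
    {T : W.geomPoints}
    (hT : pointsMap W w.Completion T =
      W.baseChangeGeomPointsEquiv w.Completion (toGeomPoints (W.baseChange w.Completion) (.some _ _ h₃w)))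
    {σ : absoluteGaloisGroup w.Completion} (hσ : σ ≠ 1) {a : W.geomPoints} (ha : a + a = T) :
    resGal (K := ℚ) w.Completion σ • a = -a := by
  haveI := finite_absoluteGaloisGroup_completion_infinitePlace w
  have hG2 := natCard_absoluteGaloisGroup_completion_infinitePlace_le_two w
  -- `a` is affine (`2a = T ≠ O`)
  have hT0 : T ≠ 0 := by
    intro hT0
    rw [hT0, map_zero] at hT
    have h0 : toGeomPoints (W.baseChange w.Completion) (.some _ _ h₃w) = 0 :=
      (W.baseChangeGeomPointsEquiv w.Completion).injective (by rw [← hT, map_zero])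
    exact WeierstrassCurve.Affine.Point.some_ne_zero _
      (toGeomPoints_injective (W.baseChange w.Completion) (by rw [h0, map_zero]))
  have hne : a ≠ 0 := fun h0 ↦ hT0 (by rw [← ha, h0, add_zero])
  obtain ⟨x, y, hxy, hae⟩ : ∃ (x y : AlgebraicClosure ℚ)
      (hxy : (W.baseChange (AlgebraicClosure ℚ)).toAffine.Nonsingular x y), a = .some x y hxy := by
    rcases a with _ | ⟨x, y, hxy⟩
    · exact absurd rfl hne
    · exact ⟨x, y, hxy, rfl⟩
  -- the image `Q = (X, Y)` of `a` in `E(ℚ̄_w)` and the point `T₃` there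
  have hXY : (W.baseChange (AlgebraicClosure w.Completion)).toAffine.Nonsingular
      (closureEmb (K := ℚ) w.Completion x) (closureEmb (K := ℚ) w.Completion y) :=
    (WeierstrassCurve.Affine.baseChange_nonsingular (W := W.toAffine) (f := closureEmb (K := ℚ) w.Completion)
      (closureEmb (K := ℚ) w.Completion).injective x y).mpr hxy
  have h₃ : (W.baseChange (AlgebraicClosure w.Completion)).toAffine.Nonsingular
      (algebraMap w.Completion _ e₃)
      (algebraMap w.Completion _ ((W.baseChange w.Completion).toAffine.twoTorsionY e₃)) :=
    (WeierstrassCurve.Affine.baseChange_nonsingular (W := W.toAffine)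
      (f := IsScalarTower.toAlgHom ℚ w.Completion (AlgebraicClosure w.Completion))
      (algebraMap w.Completion (AlgebraicClosure w.Completion)).injective _ _).mpr h₃w
  have hQ : pointsMap W w.Completion a = .some _ _ hXY := by rw [hae]; rfl
  have hTimg : pointsMap W w.Completion T = .some _ _ h₃ := by rw [hT, algPoint_some W w h₃w h₃]
  have h2Q : (WeierstrassCurve.Affine.Point.some _ _ hXY :
      (W.baseChange (AlgebraicClosure w.Completion)).toAffine.Point) + .some _ _ hXY = .some _ _ h₃ := by
    have := congrArg (pointsMap W w.Completion) ha
    rw [map_add, hQ, hTimg] at this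
    exact this
  -- the abscissa is real, hence fixed
  have hXfix : σ • closureEmb (K := ℚ) w.Completion x = closureEmb (K := ℚ) w.Completion x := by
    rcases exists_fst_eq_algebraMap_of_add_self_eq_T₃ W w h hs hXY h₃ h2Q with hx | hx <;>
      · rw [hx]; exact smul_algebraMap w σ _
  -- so `σ • Q = Q` or `σ • Q = -Q`
  have hσY : (W.baseChange (AlgebraicClosure w.Completion)).toAffine.Equation
      (closureEmb (K := ℚ) w.Completion x) (σ • closureEmb (K := ℚ) w.Completion y) := by
    have := (nonsingular_smul W w σ hXY).1
    rwa [hXfix] at this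
  have hσQ : σ • pointsMap W w.Completion a = pointsMap W w.Completion a ∨
      σ • pointsMap W w.Completion a = -pointsMap W w.Completion a := by
    rw [hQ, localPoints_smul_some W w σ hXY (nonsingular_smul W w σ hXY)]
    rcases WeierstrassCurve.Affine.Y_eq_of_X_eq hσY hXY.1 rfl with hY | hY
    · exact Or.inl (some_eq_some_localPoints W w hXfix hY)
    · exact Or.inr ((some_eq_some_localPoints W w hXfix hY).trans
        (WeierstrassCurve.Affine.Point.neg_some hXY).symm)
  rcases hσQ with hfix | hneg
  · -- `a` real: then `T₃ ∈ 2E(ℚ_w)`, contradiction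
    exfalso
    have hall : ∀ τ : absoluteGaloisGroup w.Completion,
        τ • pointsMap W w.Completion a = pointsMap W w.Completion a := by
      intro τ
      by_cases hτ : τ = 1
      · rw [hτ, one_smul]
      · rw [eq_of_ne_one_of_natCard_le_two hG2 hτ hσ]; exact hfix
    obtain ⟨Q₀, hQ₀⟩ := exists_algPoint_eq_of_forall_smul_eq W w hall
    apply hT₃ Q₀
    apply toGeomPoints_injective (W.baseChange w.Completion)
    apply (W.baseChangeGeomPointsEquiv w.Completion).injective
    rw [map_add, map_add, hQ₀, ← map_add, ha, hT]
  · apply pointsMapOfEmb_injective W (closureEmb (K := ℚ) w.Completion)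
    change pointsMap W w.Completion (resGal (K := ℚ) w.Completion σ • a) = pointsMap W w.Completion (-a)
    rw [pointsMap_smul, map_neg]
    exact hneg

end HalfPoint

end Summit.BirchSwinnertonDyer.BirchSwinnertonDyer.Theorems.MultTransportAtTwo

end
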